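import Literature.MeasureTheory.Integral.PushforwardDensityGluing
import Literature.MeasureTheory.Integral.SubmersionPushforwardDensity
import Literature.MeasureTheory.Integral.AnalyticSubmersionSharpDensity

/-!
# THE PUSH-FORWARD OF A COMPACTLY SUPPORTED DENSITY UNDER A C¹ SUBMERSION HAS A DENSITY CONTINUOUS ON THE WHOLE TARGET
# — and the sharp-threshold edition ([HormanderALPDO1] §6.1, proof of Thm 6.1.2; [EvansGariepy1992] §3.4.3)

Generic calculus ∕ measure theory on finite-dimensional real spaces; every declaration is a THEOREM proved here (no `def`, no
named fact, no `sorry`).  LOCATED CONSUMER (cell `pub-ymgap`, YM-PLAN Track A, node N09 [B12] width seat `pub-ymgap-dag-n09-w2`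
g4, `--supports` K1⁷ `StabilityBAtRecordR13SepCoPH` = stmt-QuantumFields-20542, count-neutral helper): node00-def-K0e's located
debt (F1) «the Jacobian face of [Balaban1987RG1] (0.4)'s disintegration».  This is the GLOBAL form of the two local engines of
this directory — `SubmersionPushforward.exists_continuousOn_density_map_of_submersion` (p610570) and
`AnalyticSubmersion.exists_continuousOn_density_map_of_analytic_submersion_sharp` (p613264) — obtained from them by the
partition-of-unity gluing `PushforwardDensityGluing.exists_continuous_density_of_locally'` (this seat): the HONEST-SCOPE item
(i) of p610570 («a partition of unity over a compact regular region is not done here») is discharged.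

WHAT IS PROVED (namespace `Literature.MeasureTheory.Integral.SubmersionPushforwardGlobal`; `E`, `Y` finite-dimensional real
normed spaces with additive Haar measures `μE`, `μY`; `M : E → Y` measurable).
* ★★ `exists_continuous_density_map_of_submersion_of_isCompact` — if `M` is `C¹` with surjective differential at every point
  of a compact `K`, then every measurable bounded `r ≥ 0` vanishing off `K` and continuous at each point of `K` has a
  push-forward density `I ≥ 0`, CONTINUOUS ON ALL OF `Y`: `(r·μE)(M⁻¹A) = ∫⁻_A I dμY` for every measurable `A`.
  `exists_continuous_density_map_of_submersion_of_subset_isOpen` — the same from `ContDiffOn ℝ 1 M 𝒪`, surjective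
  differentials on an open `𝒪 ⊇ K`, `r` continuous on `𝒪`.
* ★★ `exists_continuous_density_map_of_submersion_sharp_of_isCompact` — SHARP THRESHOLDS: `g : E → ℝ` continuous at the
  points of `K`; `M` `C¹` with surjective differential on `K`; at the points of `K ∩ {g = 0}` moreover `M` and `g` real-analytic
  and `g` TRANSVERSE to the fibre (`∃ v ∈ ker DM(a), Dg(a) v ≠ 0`); then every measurable bounded `r ≥ 0` vanishing off `K` and
  continuous at each `x ∈ K` with `g x ≠ 0` (the `𝟙_{g<0}·r₀` shape of a sharp small-field indicator) has a push-forward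
  density continuous on all of `Y`.  (At a point with `g a ≠ 0` the `C¹` engine is used with its window CUT DOWN to
  `O ∩ int{g ≠ 0}` — the sharp form of the gluing theorem; at a threshold point the sharp engine.)
* `integral_mul_comp_eq_of_submersion_of_isCompact` — the test-function reading
  `∫ r x * f (M x) dμE = ∫ I W * f W dμY` (every measurable real `f`), via `PushforwardDensityGluing`.

HONEST SCOPE.  Nothing model-specific (no claim about Bałaban's averaging, N09 or the Clay problem); the submersion ∕
transversality ∕ analyticity inputs at the record stay the consumer's.  The glued density's VALUE is chart- and
partition-dependent bookkeeping; its existence and continuity are not.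
-/

noncomputable section

namespace Literature.MeasureTheory.Integral.SubmersionPushforwardGlobal

open _root_.MeasureTheory _root_.MeasureTheory.Measure Set Function Filter
open scoped ENNReal NNReal Topology

variable {E Y : Type*}
  [NormedAddCommGroup E] [NormedSpace ℝ E] [FiniteDimensional ℝ E] [MeasurableSpace E] [BorelSpace E]
  [NormedAddCommGroup Y] [NormedSpace ℝ Y] [FiniteDimensional ℝ Y] [MeasurableSpace Y] [BorelSpace Y]

/-- ★★ **THE PUSH-FORWARD OF A COMPACTLY SUPPORTED DENSITY UNDER A `C¹` SUBMERSION HAS A CONTINUOUS DENSITY — GLOBALLY.**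
`M : E → Y` measurable, `C¹` with surjective differential at every point of a compact set `K`; `r ≥ 0` measurable, bounded,
vanishing off `K`, continuous at each point of `K`.  Then there is `I : Y → ℝ`, `I ≥ 0`, CONTINUOUS ON ALL OF `Y`, with
`(r·μE)(M⁻¹A) = ∫⁻_A I dμY` for every measurable `A`.  (p610570 at each point of `K` + the partition-of-unity gluing.)
[cite: HormanderALPDO1, §6.1, proof of Thm 6.1.2 (push-forward under a submersion)] [cite: EvansGariepy1992, §3.4.3 Thm 2 (C¹-submersion special case)] -/
theorem exists_continuous_density_map_of_submersion_of_isCompact (μE : Measure E) [μE.IsAddHaarMeasure] (μY : Measure Y)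
    [μY.IsAddHaarMeasure] {M : E → Y} (hMm : Measurable M) {K : Set E} (hK : IsCompact K)
    (hM : ∀ a ∈ K, ContDiffAt ℝ 1 M a) (hsurj : ∀ a ∈ K, (fderiv ℝ M a).range = ⊤)
    (r : E → ℝ) (hrm : Measurable r) (hr0 : ∀ x, 0 ≤ r x) (hrc : ∀ x ∈ K, ContinuousAt r x)
    (hrC : ∃ C : ℝ, ∀ x, r x ≤ C) (hrK : ∀ x, x ∉ K → r x = 0) :
    ∃ I : Y → ℝ, Continuous I ∧ (∀ W, 0 ≤ I W) ∧ ∀ A : Set Y, MeasurableSet A →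
      (μE.withDensity fun x => ENNReal.ofReal (r x)) (M ⁻¹' A) = ∫⁻ W in A, ENNReal.ofReal (I W) ∂μY := by
  refine PushforwardDensityGluing.exists_continuous_density_of_locally μE μY hMm (fun _ => True) hK
    (fun a ha => ?_) r hrm hr0 (fun x hx _ => hrc x hx) hrC hrK
  obtain ⟨O, hO, haO, D, hD, haD, hH⟩ :=
    SubmersionPushforward.exists_continuousOn_density_map_of_submersion μE μY hMm (hM a ha) (hsurj a ha)
  refine ⟨O, D, (hM a ha).continuousAt, hO, haO, hD, haD, fun r' h1 h2 h3 h4 h5 => ?_⟩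
  obtain ⟨C', hC'⟩ := h4
  exact hH r' h1 h2 (fun x hx => (h3 x hx trivial).continuousWithinAt) ⟨C', fun x _ => hC' x⟩ h5

/-- **The same from data on an open neighbourhood**: `M` `C¹` on an open `𝒪 ⊇ K` with surjective differentials there and `r`
continuous on `𝒪`, vanishing off the compact `K`. [cite: HormanderALPDO1, §6.1, proof of Thm 6.1.2 (push-forward under a submersion)] -/
theorem exists_continuous_density_map_of_submersion_of_subset_isOpen (μE : Measure E) [μE.IsAddHaarMeasure]
    (μY : Measure Y) [μY.IsAddHaarMeasure] {M : E → Y} (hMm : Measurable M) {𝒪 K : Set E} (h𝒪 : IsOpen 𝒪)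
    (hK : IsCompact K) (hK𝒪 : K ⊆ 𝒪) (hM : ContDiffOn ℝ 1 M 𝒪) (hsurj : ∀ a ∈ 𝒪, (fderiv ℝ M a).range = ⊤)
    (r : E → ℝ) (hrm : Measurable r) (hr0 : ∀ x, 0 ≤ r x) (hrc : ContinuousOn r 𝒪)
    (hrC : ∃ C : ℝ, ∀ x, r x ≤ C) (hrK : ∀ x, x ∉ K → r x = 0) :
    ∃ I : Y → ℝ, Continuous I ∧ (∀ W, 0 ≤ I W) ∧ ∀ A : Set Y, MeasurableSet A →
      (μE.withDensity fun x => ENNReal.ofReal (r x)) (M ⁻¹' A) = ∫⁻ W in A, ENNReal.ofReal (I W) ∂μY :=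
  exists_continuous_density_map_of_submersion_of_isCompact μE μY hMm hK
    (fun _ ha => hM.contDiffAt (h𝒪.mem_nhds (hK𝒪 ha))) (fun a ha => hsurj a (hK𝒪 ha)) r hrm hr0
    (fun _ hx => hrc.continuousAt (h𝒪.mem_nhds (hK𝒪 hx))) hrC hrK

/-- ★★ **SHARP THRESHOLDS, GLOBALLY.**  `M : E → Y` measurable, `C¹` with surjective differential at every point of a compact
`K`; a threshold function `g : E → ℝ` continuous at the points of `K`, and at every `a ∈ K` with `g a = 0` moreover `M`, `g`
real-analytic at `a` and `g` TRANSVERSE to the fibre through `a` (`∃ v ∈ ker DM(a), Dg(a) v ≠ 0`).  Then every measurable bounded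
`r ≥ 0` vanishing off `K` and continuous at each `x ∈ K` with `g x ≠ 0` has a push-forward density `I ≥ 0` CONTINUOUS ON ALL OF
`Y`, `(r·μE)(M⁻¹A) = ∫⁻_A I dμY` for every measurable `A`.  (Sharp-form gluing: at `g a ≠ 0` the `C¹` engine p610570 with its window cut
down to `O ∩ int{g ≠ 0}`, at `g a = 0` the sharp engine p613264.)
[cite: HormanderALPDO1, §6.1, proof of Thm 6.1.2 (push-forward under a submersion)] [cite: Mityagin2015, Proposition 1] -/
theorem exists_continuous_density_map_of_submersion_sharp_of_isCompact (μE : Measure E) [μE.IsAddHaarMeasure]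
    (μY : Measure Y) [μY.IsAddHaarMeasure] {M : E → Y} (hMm : Measurable M) {K : Set E} (hK : IsCompact K)
    (hM : ∀ a ∈ K, ContDiffAt ℝ 1 M a) (hsurj : ∀ a ∈ K, (fderiv ℝ M a).range = ⊤)
    {g : E → ℝ} (hgc : ∀ a ∈ K, ContinuousAt g a)
    (hzero : ∀ a ∈ K, g a = 0 → AnalyticAt ℝ M a ∧ AnalyticAt ℝ g a ∧ ∃ v ∈ (fderiv ℝ M a).ker, fderiv ℝ g a v ≠ 0)
    (r : E → ℝ) (hrm : Measurable r) (hr0 : ∀ x, 0 ≤ r x) (hrc : ∀ x ∈ K, g x ≠ 0 → ContinuousAt r x)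
    (hrC : ∃ C : ℝ, ∀ x, r x ≤ C) (hrK : ∀ x, x ∉ K → r x = 0) :
    ∃ I : Y → ℝ, Continuous I ∧ (∀ W, 0 ≤ I W) ∧ ∀ A : Set Y, MeasurableSet A →
      (μE.withDensity fun x => ENNReal.ofReal (r x)) (M ⁻¹' A) = ∫⁻ W in A, ENNReal.ofReal (I W) ∂μY := by
  refine PushforwardDensityGluing.exists_continuous_density_of_locally' μE μY hMm (fun x => g x ≠ 0) hK
    (fun a ha => ?_) r hrm hr0 hrc hrC hrK
  by_cases hga : g a = 0
  · -- threshold point: the sharp engine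
    obtain ⟨hMan, hgan, htr⟩ := hzero a ha hga
    obtain ⟨O, hO, haO, D, hD, haD, hH⟩ :=
      AnalyticSubmersion.exists_continuousOn_density_map_of_analytic_submersion_sharp μE μY hMm hMan (hsurj a ha)
        hgan htr
    refine ⟨O, D, (hM a ha).continuousAt, hO, haO, hD, haD, fun r' h1 h2 h3 h4 h5 => ?_⟩
    obtain ⟨C', hC'⟩ := h4
    exact hH r' h1 h2 (fun x _ hgx => h3 x fun _ => hgx) ⟨C', fun x _ => hC' x⟩ h5
  · -- regular value of `g`: the `C¹` engine, its window CUT DOWN to `O ∩ interior {g ≠ 0}`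
    obtain ⟨O, hO, haO, D, hD, haD, hH⟩ :=
      SubmersionPushforward.exists_continuousOn_density_map_of_submersion μE μY hMm (hM a ha) (hsurj a ha)
    have haint : a ∈ interior {x | g x ≠ 0} :=
      mem_interior_iff_mem_nhds.2 ((hgc a ha).preimage_mem_nhds (isOpen_ne.mem_nhds hga))
    refine ⟨O ∩ interior {x | g x ≠ 0}, D, (hM a ha).continuousAt, hO.inter isOpen_interior, ⟨haO, haint⟩, hD, haD,
      fun r' h1 h2 h3 h4 h5 => ?_⟩
    obtain ⟨C', hC'⟩ := h4
    refine hH r' h1 h2 (fun x _ => (h3 x fun hx' => ?_).continuousWithinAt) ⟨C', fun x _ => hC' x⟩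
      fun x hx => h5 x fun hx' => hx hx'.1
    have : x ∈ {x | g x ≠ 0} := interior_subset hx'.2
    exact this

/-- **The test-function reading** of `exists_continuous_density_map_of_submersion_of_isCompact`:
`∫ r x * f (M x) dμE = ∫ I W * f W dμY` for every measurable real test `f`, with `I ≥ 0` continuous on `Y`.
[cite: HormanderALPDO1, §6.1, proof of Thm 6.1.2 (push-forward under a submersion)] -/
theorem integral_mul_comp_eq_of_submersion_of_isCompact (μE : Measure E) [μE.IsAddHaarMeasure] (μY : Measure Y)
    [μY.IsAddHaarMeasure] {M : E → Y} (hMm : Measurable M) {K : Set E} (hK : IsCompact K)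
    (hM : ∀ a ∈ K, ContDiffAt ℝ 1 M a) (hsurj : ∀ a ∈ K, (fderiv ℝ M a).range = ⊤)
    (r : E → ℝ) (hrm : Measurable r) (hr0 : ∀ x, 0 ≤ r x) (hrc : ∀ x ∈ K, ContinuousAt r x)
    (hrC : ∃ C : ℝ, ∀ x, r x ≤ C) (hrK : ∀ x, x ∉ K → r x = 0) :
    ∃ I : Y → ℝ, Continuous I ∧ (∀ W, 0 ≤ I W) ∧ ∀ f : Y → ℝ, Measurable f →
      ∫ x, r x * f (M x) ∂μE = ∫ W, I W * f W ∂μY := by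
  obtain ⟨I, hIc, hI0, hIA⟩ := exists_continuous_density_map_of_submersion_of_isCompact μE μY hMm hK hM hsurj r hrm
    hr0 hrc hrC hrK
  exact ⟨I, hIc, hI0, fun f hf =>
    PushforwardDensityGluing.integral_mul_comp_eq_integral_mul_of_forall_preimage μE μY hMm hrm hr0 hIc.measurable
      hI0 hIA hf⟩

end Literature.MeasureTheory.Integral.SubmersionPushforwardGlobal

end
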